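import Summits.ABC.IUTFork.Conditional.LayerC312OfS
import Summits.ABC.IUTFork.DAGC312p

/-!
# Branch C — layer certificate C312, companion: the 21 PROOF-STEP nodes of [IUTchIII] Cor. 3.12 modulo S (rung LADDER-ABC:A2.C)

Companion of `Conditional/LayerC312OfS.lean` (abc-iut-c312-2 gen 4; spec HOME/plan/C/ABC-OF-S-SPEC.md v0 §3). NOT COUNTED on the C
scoreboard: the 21 proof-step rows of layer C312 (`IUTchIII:Cor3.12.pf(WLOG)`, `(i)`–`(xii)`, `(xi-a)`–`(xi-h)`; kernel ids
`N_IUTchIII_Cor3_12_pf_<s>`, DAGC312b) are NOT members of the cone (HOME/plan/COR312-CONE.tsv is the backward STATEMENT-citation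
closure) — they are the CONTENT of the passage Thm 3.11 ⟹ Cor 3.12, this lineage's chain. They are certified here so that nothing the
layer holds is left uncertified.

THIS FILE PROVES NOTHING NEW AND ASSERTS NOTHING. Under the readings of record `(lociReadingI F pending, obsReadingA F pending Pc Dk)`
(DAGC312o/p) nineteen of the twenty inferences are theorems — sixteen outright, three under named side data of the instantiation — and
the twentieth, (xi-f), the node citing no locus, is EQUIVALENT to the Statement (`DAG.N_IUTchIII_Cor3_12_pf_xi_f_iff`, Δ7 p416436); the
counted certificate `layerC312_of_S` gives the Statement from S + pins + bridge + typed Thm 3.11; so the WHOLE twenty-node chain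
`DAG.N_IUTchIII_Cor3_12_pf` follows (`layerC312_steps_of_S`), and each of the 21 named step nodes (`layerC312_step_nodes_of_S`; the
header (xi) is the conjunction of its eight substeps). Side binders [SIDE] ×5: `hIndAdm`, `hIndVol`, `hMono` (coarse-space properties
of the line's data `F.D Pc.n`: admissibility invariance on the (Ind1)/(Ind2) generators, `LogvolInvariant`, monotonicity over ALL
labels — TEAM B rows B-2/B-4 discharge them for the real containers), `hNE` (nonempty strip isomorphisms, Def. 3.8 (ii)'s
presupposition; `Cor312Proof.hNE_satisfiable`), `hqpos : Pc.AbsLogQPos` ("`|log(q)| > 0`", p. 174 l. 13; NECESSARY for (xi-d),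
abc-iut-c312-4 `thetaFinite_of_comparableObjects`); `ThetaFinite` is `hBridge.finite`. Would-be count S 1 · PIN 2 · CONE 1 · SIDE 5 = 9.

CO-IMPORT NOTE (abc-iut-w5-d104 sentinel F1-SIDES-0606Z, breaker F1): this file imports DAGC312p, hence Cor312TeamAChain — side A
of F1; do not co-import it with a side-B module (the Cor312MultiradTwist / Cor312PilotKummerCompat / Cor312Pinned{Countermodel,…} /
Repair.* closure, 57 modules at 06:06Z) until F1 is repaired. The counted certificate `LayerC312OfS` and `Conditional/AbcOfS` (p427180)
are NEUTRAL; an apex that wants these step nodes together with side-B material must wait for the F1 repair (c312-4 rename v2).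

HONEST FRAMING: locates / conditionally verifies. Nothing here asserts that abc is proved or refuted, or takes a side on [IUTchIII]
Cor. 3.12 or on any author; S is an assumption label; Theorem 3.11 enters as a NAMED HYPOTHESIS. typed ≠ proved; indexed ≠ endorsed.
[claim: Mochizuki2012, status: disputed]
-/

noncomputable section

namespace Summit.ABC.IUTFork.Conditional

open Thm311 Cor312 Cor312Vol Cor312Proof DAG
open Literature.IUT.LogThetaLattice

variable {T : ThetaIndex}


/-- **The twenty-node chain of the proof of Cor. 3.12 under the readings of record, modulo S.** S + pins + bridge + typed Thm 3.11 give
the Statement (§1), the Statement gives the one node (xi-f) (`N_IUTchIII_Cor3_12_pf_xi_f_iff`, DAGC312p), and the nineteen other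
inferences are theorems under the named side data (`chain_of_record`, DAGC312p Δ7): hence the whole chain node
`N_IUTchIII_Cor3_12_pf (lociReadingI F pending) (obsReadingA F pending Pc Dk)`. Side binders [SIDE] ×5: `hIndAdm`, `hIndVol`, `hMono`
(coarse-space properties of `F.D Pc.n`), `hNE` (strip isomorphisms nonempty), `hqpos` (`|log(q)| > 0`); `ThetaFinite` is
`hBridge.finite`. Would-be count S 1 · PIN 2 · CONE 1 · SIDE 5 = 9. [claim: Mochizuki2012, status: disputed] -/
theorem layerC312_steps_of_S (F : FullSituation T) (pending : Locus → Prop)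
    (Pc : Cor312.Setting F.toLatticeSituation.toSituation) (Dk : ThetaLinkStrips Pc.LogLink Pc.Strip)
    (ρ : (∀ v : T.V, v ∈ T.Vbad → Set (F.L.StarPacket v)) → ∀ (j : T.Label) (vQ : T.VQ), Set (F.L.Packet j vQ))
    (qK : ∀ v : T.V, v ∈ T.Vbad → Set (F.L.StarPacket v))
    (hS : PilotKummerIndRelated F.toLatticeSituation Pc ρ qK)
    (hPin : PinnedRegions3 F.toLatticeSituation Pc ρ qK) (hBridge : BridgeHyps Pc)
    (hThm311 : DAG.N_IUTchIII_Thm3_11 F)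
    -- [SIDE] ×5
    (hIndAdm : ∀ Φ ∈ F.L.Ind1Family ∪ F.L.Ind2Family, ∀ (j : T.Label) (vQ : T.VQ) (A : Set (F.L.Packet j vQ)),
      (F.D Pc.n).Adm j vQ A ↔ (F.D Pc.n).Adm j vQ (Φ j vQ '' A))
    (hIndVol : (F.D Pc.n).LogvolInvariant)
    (hMono : ∀ (j : T.Label) (vQ : T.VQ) (A B : Set (F.L.Packet j vQ)),
      (F.D Pc.n).Adm j vQ A → (F.D Pc.n).Adm j vQ B → A ⊆ B → (F.D Pc.n).logvol j vQ A ≤ (F.D Pc.n).logvol j vQ B)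
    (hNE : ∀ n m : ℤ, Nonempty (Pc.IsoS (Dk.stripLGP (Pc.lattice.logLink n (m - 1))) (Dk.stripDelta (Pc.lattice.theater (n + 1) m))))
    (hqpos : Pc.AbsLogQPos) :
    DAG.N_IUTchIII_Cor3_12_pf (lociReadingI F pending) (obsReadingA F pending Pc Dk) :=
  chain_of_record F pending Pc Dk hIndAdm hIndVol hMono hNE hBridge.finite hqpos
    ((N_IUTchIII_Cor3_12_pf_xi_f_iff F pending Pc Dk).2 fun _ _ =>
      (layerC312_of_S F Pc ρ qK hS hPin hBridge hThm311).2.2.2.2)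

/-- **The twenty-one named proof-step nodes of layer C312, modulo S** (kernel ids of plan/DAG.tsv rows `IUTchIII:Cor3.12.pf(WLOG)`,
`(i)`–`(x)`, `(xi-a)`–`(xi-h)`, `(xii)` and the header `(xi)` = the conjunction of its eight substeps), each BY NAME from the chain
of `layerC312_steps_of_S` — same binders. [claim: Mochizuki2012, status: disputed] -/
theorem layerC312_step_nodes_of_S (F : FullSituation T) (pending : Locus → Prop)
    (Pc : Cor312.Setting F.toLatticeSituation.toSituation) (Dk : ThetaLinkStrips Pc.LogLink Pc.Strip)
    (ρ : (∀ v : T.V, v ∈ T.Vbad → Set (F.L.StarPacket v)) → ∀ (j : T.Label) (vQ : T.VQ), Set (F.L.Packet j vQ))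
    (qK : ∀ v : T.V, v ∈ T.Vbad → Set (F.L.StarPacket v))
    (hS : PilotKummerIndRelated F.toLatticeSituation Pc ρ qK)
    (hPin : PinnedRegions3 F.toLatticeSituation Pc ρ qK) (hBridge : BridgeHyps Pc)
    (hThm311 : DAG.N_IUTchIII_Thm3_11 F)
    (hIndAdm : ∀ Φ ∈ F.L.Ind1Family ∪ F.L.Ind2Family, ∀ (j : T.Label) (vQ : T.VQ) (A : Set (F.L.Packet j vQ)),
      (F.D Pc.n).Adm j vQ A ↔ (F.D Pc.n).Adm j vQ (Φ j vQ '' A))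
    (hIndVol : (F.D Pc.n).LogvolInvariant)
    (hMono : ∀ (j : T.Label) (vQ : T.VQ) (A B : Set (F.L.Packet j vQ)),
      (F.D Pc.n).Adm j vQ A → (F.D Pc.n).Adm j vQ B → A ⊆ B → (F.D Pc.n).logvol j vQ A ≤ (F.D Pc.n).logvol j vQ B)
    (hNE : ∀ n m : ℤ, Nonempty (Pc.IsoS (Dk.stripLGP (Pc.lattice.logLink n (m - 1))) (Dk.stripDelta (Pc.lattice.theater (n + 1) m))))
    (hqpos : Pc.AbsLogQPos) :
    let L := lociReadingI F pending
    let O := obsReadingA F pending Pc Dk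
    N_IUTchIII_Cor3_12_pf_WLOG L O ∧ N_IUTchIII_Cor3_12_pf_i L O ∧ N_IUTchIII_Cor3_12_pf_ii L O ∧ N_IUTchIII_Cor3_12_pf_iii L O ∧
      N_IUTchIII_Cor3_12_pf_iv L O ∧ N_IUTchIII_Cor3_12_pf_v L O ∧ N_IUTchIII_Cor3_12_pf_vi L O ∧ N_IUTchIII_Cor3_12_pf_vii L O ∧
      N_IUTchIII_Cor3_12_pf_viii L O ∧ N_IUTchIII_Cor3_12_pf_ix L O ∧ N_IUTchIII_Cor3_12_pf_x L O ∧
      N_IUTchIII_Cor3_12_pf_xi_a L O ∧ N_IUTchIII_Cor3_12_pf_xi_b L O ∧ N_IUTchIII_Cor3_12_pf_xi_c L O ∧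
      N_IUTchIII_Cor3_12_pf_xi_d L O ∧ N_IUTchIII_Cor3_12_pf_xi_e L O ∧ N_IUTchIII_Cor3_12_pf_xi_f L O ∧
      N_IUTchIII_Cor3_12_pf_xi_g L O ∧ N_IUTchIII_Cor3_12_pf_xi_h L O ∧ N_IUTchIII_Cor3_12_pf_xii L O ∧
      N_IUTchIII_Cor3_12_pf_xi L O := by
  have h := layerC312_steps_of_S F pending Pc Dk ρ qK hS hPin hBridge hThm311 hIndAdm hIndVol hMono hNE hqpos
  exact ⟨h .wlog, h .i, h .ii, h .iii, h .iv, h .v, h .vi, h .vii, h .viii, h .ix, h .x, h .xi_a, h .xi_b, h .xi_c, h .xi_d,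
    h .xi_e, h .xi_f, h .xi_g, h .xi_h, h .xii, ⟨h .xi_a, h .xi_b, h .xi_c, h .xi_d, h .xi_e, h .xi_f, h .xi_g, h .xi_h⟩⟩

/-- STEP CENSUS of the companion (by `decide` over the landed citation data): twenty inferences in `Cor312Proof.Step.all`, the one
citing no locus is (xi-f); 21 named step nodes = 20 + the header (xi). [folklore] -/
theorem layerC312_steps_census_v0 : Step.all.length = 20 ∧ Step.xi_f.cites = [] ∧ (20 : ℕ) + 1 = 21 := by
  refine ⟨by decide, by decide, rfl⟩

end Summit.ABC.IUTFork.Conditional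

end
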